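import Literature.NumberTheory.NumberFields.AmbiguousNarrowClassNumberUnitIndex
import Literature.NumberTheory.NumberFields.NarrowClassGroupCounting
import Literature.NumberTheory.NumberFields.RelNormGaloisProduct
import HarnessLib

/-!
# Narrow genus theory: `rank₂ Cl⁺(L) = t − 1` for a totally real quadratic extension `L/K` with `h⁺(K)` odd and `t` ramified primes
# (`[Cl⁺(L) : Cl⁺(L)²] · 2 = ∏_𝔭 e_𝔭 = 2^t`), from the narrow ambiguous class number formula

Topic `NumberTheory/NumberFields`; namespace `Literature.NumberTheory.NumberFields.AmbiguousClass`.  THEOREM-ONLY file (no definition, no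
named fact, no instance, no `sorry`), written by the prover seat `cruxlead-stmt-BirchSwinnertonDyer-19573-w2` GEN 12 (cell `bsd-2adic`;
`--supports` stmt-BirchSwinnertonDyer-19573; closes nothing).  Sequel of `AmbiguousNarrowClassNumberUnitIndex.lean`
(`#Cl⁺(L)^G · 2 = h⁺(K) · 2^t`).  It supplies the EXACT narrow `2`-rank where the tree had the inequality `rank₂ Cl⁺(L) ≥ 1`
(`two_dvd_index_range_pow_two_narrowClassGroup_of_quadratic`, `QuadraticExtensionEvenNarrowClassNumber.lean`): for the totally real cubic point
fields `ℚ(P)` with `h⁺ = 1` and `t` primes ramified in `ℚ(P, √2)` (layer `1` of the cyclotomic `ℤ₂`-tower) `rank₂ Cl⁺(ℚ(P,√2)) = t − 1`.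

THE THEOREM (`index_range_pow_two_narrowClassGroup_mul_two_eq`).  `L/K` Galois of degree `2` (`Gal = ⟨σ⟩`), `L` totally real, `h⁺(K)` odd:

  **`[Cl⁺(L) : Cl⁺(L)²] · 2 = ∏_𝔭 e_𝔭(L/K)`**  (`= 2^t`, `…_eq_two_pow`: `rank₂ Cl⁺(L) = t − 1`).

PROOF (classical genus theory, Fröhlich–Taylor V / Gras IV.4).  Let `A = Cl⁺(L) = 𝓘_L/P⁺`, `N = 1 + σ` on `A`.  (§1) The norm of a
fractional ideal is extended from `K`: `I · σI = N_G(I) ∈ ι(𝓘_K)` (Neukirch III (1.6)(iv), tree `prod_smul_eq_map_relNorm`, plus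
`N_G((a)) = (N a)`), and the classes of `ι(𝓘_K)` form a group of order dividing `h⁺(K)`, which is ODD; so `N(a) = a · σa` has odd order for
every `a ∈ A`.  (§2) Hence on `A[2]` one has `σa = a⁻¹ = a`: `A[2] ⊆ A^G`; and for `a ∈ A^G`, `a² = N(a)` has odd order, so `a^m ∈ A[2]` with
`m` odd: every element of `A^G/A[2]` has odd order, so `[A^G : A[2]]` is odd (Cauchy).  (§3) `#A[2]` is a power of `2` and
`#A^G · 2 = h⁺(K) · 2^t` (`relIndex_z0_totPosPrincipalIdeals_mul_two_eq_of_odd_narrowClassNumber`); comparing `2`-parts,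
`#A[2] · 2 = 2^t`, and `[A : A²] = #A[2]` (tree `index_range_powMonoidHom_eq_card_ker'`).

* §1 `norm_mk0_mem_range`, `norm_toPrincipalIdeal_mem_range`, ★ `norm_mem_range_unitsMap_extendedHom` — `N_G(𝓘_L) ⊆ ι(𝓘_K)` (`L/K` cyclic).
* §2 `odd_relIndex_of_forall_exists_odd_pow_mem` — finite abelian groups: `T ≤ F`, every `f ∈ F` has an odd power in `T` ⟹ `[F : T]` odd.
* §3 ★ `index_range_pow_two_narrowClassGroup_mul_two_eq`, `…_eq_two_pow`.

References: [Gras2003] IV.4 (genus theory with signatures: the `2`-rank of the restricted class group of a quadratic extension); [FrohlichTaylor1990]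
Ch. V §1–§2 (narrow genus theory of quadratic fields over `ℚ`: `rank₂ Cl⁺ = t − 1`); [NeukirchANT1999] Ch. III §1 (1.6) (iv); [Lang1990] Ch. 13 §4;
[Yu2014AmbiguousClassNumberFormulas] Thm. 1.1.
-/

noncomputable section

open NumberField NumberField.InfinitePlace IsDedekindDomain FractionalIdeal
open scoped nonZeroDivisors Pointwise

namespace Literature.NumberTheory.NumberFields.AmbiguousClass

open Literature.NumberTheory.GaloisRepresentations Literature.NumberTheory.GaloisRepresentations.Herbrand
  Literature.NumberTheory.GaloisRepresentations.MinkowskiUnit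
  Literature.NumberTheory.GaloisRepresentations.CyclicNormIndex
  Literature.NumberTheory.NumberFields.AmbiguousIdeal

/-! ### Group-theoretic bookkeeping -/

section Group

/-- **`[F : T ∩ F]` is odd** when `T, F` are subgroups of a finite commutative group and every element of `F` has an ODD power in `T`
(every element of `F/(T ∩ F)` has odd order; Cauchy). [folklore] [cite: FrohlichTaylor1990, Ch. V §2 (genus theory: counting `C⁺/C⁺²`)] -/
theorem odd_relIndex_of_forall_exists_odd_pow_mem {A : Type*} [CommGroup A] [Finite A] {T F : Subgroup A}
    (h : ∀ f ∈ F, ∃ m : ℕ, Odd m ∧ f ^ m ∈ T) : Odd (T.relIndex F) := by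
  classical
  rw [← Nat.not_even_iff_odd]
  intro heven
  have hdvd : 2 ∣ Nat.card (F ⧸ T.subgroupOf F) := by
    rw [← Subgroup.index_eq_card]; exact even_iff_two_dvd.mp heven
  haveI : Fact (Nat.Prime 2) := ⟨Nat.prime_two⟩
  obtain ⟨q, hq⟩ := exists_prime_orderOf_dvd_card' 2 hdvd
  obtain ⟨f, rfl⟩ := QuotientGroup.mk_surjective q
  obtain ⟨m, hm, hfm⟩ := h f.1 f.2
  have h1 : (QuotientGroup.mk f : F ⧸ T.subgroupOf F) ^ m = 1 := by
    rw [← QuotientGroup.mk_pow, QuotientGroup.eq_one_iff, Subgroup.mem_subgroupOf, Subgroup.coe_pow]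
    exact hfm
  have h2 : 2 ∣ m := by rw [← hq]; exact orderOf_dvd_of_pow_eq_one h1
  exact (Nat.not_even_iff_odd.mpr hm) (even_iff_two_dvd.mpr h2)

end Group

variable {K L : Type} [Field K] [NumberField K] [Field L] [NumberField L] [Algebra K L]

/-! ### §1 The norm of a fractional ideal is extended from `K`: `N_G(𝓘_L) ⊆ ι(𝓘_K)` -/

omit [NumberField K] [NumberField L] in
/-- The pointwise Galois action on integral ideals is the map along `intAut σ`. [folklore] -/
private theorem pointwise_smul_eq_map_intAut (σ : L ≃ₐ[K] L) (J : Ideal (𝓞 L)) :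
    σ • J = J.map (intAut σ : 𝓞 L →+* 𝓞 L) := by
  rw [Ideal.pointwise_smul_def]
  congr 1

/-- **`N_G((𝔞)) = ι(N_{L/K} 𝔞)` for an integral ideal `𝔞` of `𝓞 L`** (`L/K` Galois; inside `𝓘_L`, `N_G = ∏_g g •`): Neukirch III (1.6) (iv)
`N_{L|K}(𝔞)𝓞_L = ∏_σ σ𝔞` (tree `prod_smul_eq_map_relNorm`) read on the units of `FractionalIdeal`. [cite: NeukirchANT1999, Ch. III §1 (1.6) Prop. (iv)] -/
theorem norm_mk0_mem_range [IsGalois K L] (J : (Ideal (𝓞 L))⁰) :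
    Herbrand.norm (L ≃ₐ[K] L) (FractionalIdeal.mk0 L J) ∈
      (Units.map (extendedHom L (𝓞 L) : FractionalIdeal (𝓞 K)⁰ K →+* FractionalIdeal (𝓞 L)⁰ L).toMonoidHom).range := by
  classical
  have hJ : (J : Ideal (𝓞 L)) ≠ ⊥ := nonZeroDivisors.ne_zero J.2
  have hN : Ideal.relNorm (𝓞 K) (J : Ideal (𝓞 L)) ≠ ⊥ := fun h => hJ (Ideal.relNorm_eq_bot_iff.mp h)
  refine ⟨FractionalIdeal.mk0 K ⟨Ideal.relNorm (𝓞 K) (J : Ideal (𝓞 L)), mem_nonZeroDivisors_iff_ne_zero.mpr hN⟩, ?_⟩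
  apply Units.ext
  rw [Units.coe_map, RingHom.toMonoidHom_eq_coe, MonoidHom.coe_coe, FractionalIdeal.coe_mk0, Herbrand.norm_apply, Units.coe_prod]
  change extendedHom L (𝓞 L) ((Ideal.relNorm (𝓞 K) (J : Ideal (𝓞 L)) : Ideal (𝓞 K)) : FractionalIdeal (𝓞 K)⁰ K) = _
  rw [extendedHom_coeIdeal_eq_map, ← NumberField.prod_smul_eq_map_relNorm K L (J : Ideal (𝓞 L)),
    show (((∏ g : L ≃ₐ[K] L, g • (J : Ideal (𝓞 L)) : Ideal (𝓞 L)) : FractionalIdeal (𝓞 L)⁰ L)) =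
      ∏ g : L ≃ₐ[K] L, (((g • (J : Ideal (𝓞 L)) : Ideal (𝓞 L))) : FractionalIdeal (𝓞 L)⁰ L) from
      map_prod (coeIdealHom (𝓞 L)⁰ L) _ _]
  refine Finset.prod_congr rfl fun g _ => ?_
  rw [smul_mk0, FractionalIdeal.coe_mk0, pointwise_smul_eq_map_intAut]

/-- **`N_G((a)) = ι((N a))` for `a ∈ Lˣ`**: the norm of a principal ideal is the extension of the principal ideal of the norm
(`L/K` cyclic, `Gal = ⟨σ⟩`: `N_G a ∈ Kˣ`). [cite: NeukirchANT1999, Ch. III §1 (1.6) Prop. (iii)–(v)] -/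
theorem norm_toPrincipalIdeal_mem_range [IsGalois K L] {σ : L ≃ₐ[K] L}
    (hσ : ∀ τ : L ≃ₐ[K] L, τ ∈ Subgroup.zpowers σ) (a : Lˣ) :
    Herbrand.norm (L ≃ₐ[K] L) (toPrincipalIdeal (𝓞 L) L a) ∈
      (Units.map (extendedHom L (𝓞 L) : FractionalIdeal (𝓞 K)⁰ K →+* FractionalIdeal (𝓞 L)⁰ L).toMonoidHom).range := by
  have hπ : ∀ (g : L ≃ₐ[K] L) (x : Lˣ),
      toPrincipalIdeal (𝓞 L) L (g • x) = g • toPrincipalIdeal (𝓞 L) L x := toPrincipalIdeal_smul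
  rw [← map_norm_eq (toPrincipalIdeal (𝓞 L) L) hπ]
  obtain ⟨k, hk⟩ := map_norm_top_le_range_unitsIncl hσ ⟨a, Subgroup.mem_top a, rfl⟩
  rw [← hk, ← unitsMap_extendedHom_toPrincipalIdeal]
  exact ⟨_, rfl⟩

/-- ★ **The norm of an invertible fractional ideal of `L` is extended from `K`: `N_G(I) ∈ ι(𝓘_K)`** (`L/K` cyclic, `Gal = ⟨σ⟩`; `N_G I = ∏_g g • I`):
write `I = (a)⁻¹ · 𝔞` with `𝔞` integral (Mathlib `exists_eq_spanSingleton_mul`) and use the two previous lemmas.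
[cite: NeukirchANT1999, Ch. III §1 (1.6) Prop. (iv)–(v)] -/
theorem norm_mem_range_unitsMap_extendedHom [IsGalois K L] {σ : L ≃ₐ[K] L}
    (hσ : ∀ τ : L ≃ₐ[K] L, τ ∈ Subgroup.zpowers σ) (I : (FractionalIdeal (𝓞 L)⁰ L)ˣ) :
    Herbrand.norm (L ≃ₐ[K] L) I ∈
      (Units.map (extendedHom L (𝓞 L) : FractionalIdeal (𝓞 K)⁰ K →+* FractionalIdeal (𝓞 L)⁰ L).toMonoidHom).range := by
  obtain ⟨a, J, ha, hI⟩ := exists_eq_spanSingleton_mul (I : FractionalIdeal (𝓞 L)⁰ L)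
  have ha' : (algebraMap (𝓞 L) L a) ≠ 0 := by
    rwa [ne_eq, IsFractionRing.to_map_eq_zero_iff]
  have hJ : J ≠ ⊥ := by
    rintro rfl
    rw [coeIdeal_bot, mul_zero] at hI
    exact I.ne_zero hI
  set aU : Lˣ := Units.mk0 (algebraMap (𝓞 L) L a) ha' with haU
  have hIeq : I = (toPrincipalIdeal (𝓞 L) L aU)⁻¹ * FractionalIdeal.mk0 L ⟨J, mem_nonZeroDivisors_iff_ne_zero.mpr hJ⟩ := by
    apply Units.ext
    rw [Units.val_mul, Units.val_inv_eq_inv_val, coe_toPrincipalIdeal, FractionalIdeal.coe_mk0, spanSingleton_inv, hI]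
    rfl
  rw [hIeq, map_mul, map_inv]
  exact Subgroup.mul_mem _ (Subgroup.inv_mem _ (norm_toPrincipalIdeal_mem_range hσ aU)) (norm_mk0_mem_range _)

/-! ### §2 `2`-adic bookkeeping -/

/-- `2^x · m = 2^y · n` with `m, n` odd forces `x = y`. [folklore] -/
private theorem pow_two_mul_odd_inj {x y m n : ℕ} (hm : Odd m) (hn : Odd n) (h : 2 ^ x * m = 2 ^ y * n) : x = y := by
  have hm0 : m ≠ 0 := by rintro rfl; exact (Nat.not_even_iff_odd.mpr hm) Even.zero
  have hn0 : n ≠ 0 := by rintro rfl; exact (Nat.not_even_iff_odd.mpr hn) Even.zero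
  have hv := congrArg (padicValNat 2) h
  rw [padicValNat.mul (pow_ne_zero _ two_ne_zero) hm0, padicValNat.mul (pow_ne_zero _ two_ne_zero) hn0,
    padicValNat.prime_pow, padicValNat.prime_pow,
    padicValNat.eq_zero_of_not_dvd (fun h2 => (Nat.not_even_iff_odd.mpr hm) (even_iff_two_dvd.mpr h2)),
    padicValNat.eq_zero_of_not_dvd (fun h2 => (Nat.not_even_iff_odd.mpr hn) (even_iff_two_dvd.mpr h2))] at hv
  simpa using hv

omit [NumberField K] [NumberField L] in
/-- In a Galois extension of degree `2` a generator `σ` of the Galois group is `≠ 1` and `G = {1, σ}`; hence `N_G I = I · σI` on any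
`G`-module. [folklore] [cite: NeukirchANT1999, Ch. III §1 (1.6) (iv) (quadratic case)] -/
theorem norm_eq_mul_smul_of_finrank_eq_two [FiniteDimensional K L] [IsGalois K L] {σ : L ≃ₐ[K] L}
    (hσ : ∀ τ : L ≃ₐ[K] L, τ ∈ Subgroup.zpowers σ) (h2 : Module.finrank K L = 2)
    {M : Type*} [CommGroup M] [MulDistribMulAction (L ≃ₐ[K] L) M] (x : M) :
    Herbrand.norm (L ≃ₐ[K] L) x = x * σ • x := by
  classical
  have hσ1 : σ ≠ 1 := by
    intro h1
    have hcard : Nat.card (L ≃ₐ[K] L) = 1 := by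
      rw [← orderOf_eq_card_of_forall_mem_zpowers hσ, h1, orderOf_one]
    rw [IsGalois.card_aut_eq_finrank, h2] at hcard
    exact absurd hcard (by norm_num)
  have huniv : (Finset.univ : Finset (L ≃ₐ[K] L)) = {1, σ} := by
    symm
    apply Finset.eq_of_subset_of_card_le (Finset.subset_univ _)
    rw [Finset.card_univ, ← Nat.card_eq_fintype_card, IsGalois.card_aut_eq_finrank, h2, Finset.card_pair hσ1.symm]
  rw [Herbrand.norm_apply, huniv, Finset.prod_pair hσ1.symm, one_smul]

/-! ### §3 `rank₂ Cl⁺(L) = t − 1` -/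

/-- ★ **Narrow genus theory for a totally real quadratic extension over a base with odd narrow class number**: `L/K` Galois of degree `2`
(`Gal = ⟨σ⟩`), `L` totally real, `h⁺(K)` odd ⟹ **`[Cl⁺(L) : Cl⁺(L)²] · 2 = ∏_𝔭 e_𝔭(L/K)`**, i.e. `rank₂ Cl⁺(L) = t − 1` with `t` the number
of finite primes of `K` ramified in `L` (`…_eq_two_pow`).  Proof: inside `A = 𝓘_L/P⁺` the norms `N a = a · σa` have ODD order (§1: `N_G I ∈ ι𝓘_K`,
whose classes form a group of order dividing `h⁺(K)`), so `A[2] ≤ A^G` and `[A^G : A[2]]` is odd (§2); `#A^G · 2 = h⁺(K) · 2^t`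
(`relIndex_z0_totPosPrincipalIdeals_mul_two_eq_of_odd_narrowClassNumber`) and `#A[2] = 2^a` give `#A[2] · 2 = 2^t`, and `[A : A²] = #A[2]`.
[cite: Gras2003, IV.4 (genus theory with signatures)] [cite: FrohlichTaylor1990, Ch. V §2 (genus theory: `rank₂ C⁺ = t − 1`)]
[cite: Yu2014AmbiguousClassNumberFormulas, Thm. 1.1] -/
theorem index_range_pow_two_narrowClassGroup_mul_two_eq [IsGalois K L] [IsTotallyReal L] {σ : L ≃ₐ[K] L}
    (hσ : ∀ τ : L ≃ₐ[K] L, τ ∈ Subgroup.zpowers σ) (h2 : Module.finrank K L = 2) (hK : Odd (narrowClassNumber K)) :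
    (powMonoidHom (α := NarrowClassGroup L) 2).range.index * 2 =
      ∏ᶠ v : HeightOneSpectrum (𝓞 K), v.asIdeal.ramificationIdxIn (𝓞 L) := by
  classical
  haveI : FiniteDimensional K L := Module.Finite.of_restrictScalars_finite ℚ K L
  -- notation
  set P : Subgroup (FractionalIdeal (𝓞 L)⁰ L)ˣ := totPosPrincipalIdeals L with hP
  set ι := (Units.map (extendedHom L (𝓞 L) :
      FractionalIdeal (𝓞 K)⁰ K →+* FractionalIdeal (𝓞 L)⁰ L).toMonoidHom) with hι
  set Z := z0 σ ⊤ P with hZ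
  -- the quotient `A = 𝓘_L / P⁺`
  set mk : (FractionalIdeal (𝓞 L)⁰ L)ˣ →* (FractionalIdeal (𝓞 L)⁰ L)ˣ ⧸ P := QuotientGroup.mk' P with hmk
  have hmk_ker : mk.ker = P := QuotientGroup.ker_mk' P
  have hmk_surj : Function.Surjective mk := QuotientGroup.mk'_surjective P
  have hmk_eq : ∀ I J : (FractionalIdeal (𝓞 L)⁰ L)ˣ, mk I = mk J ↔ I⁻¹ * J ∈ P := fun I J => QuotientGroup.eq
  haveI hfin : Finite ((FractionalIdeal (𝓞 L)⁰ L)ˣ ⧸ P) := by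
    apply Nat.finite_of_card_ne_zero
    change P.index ≠ 0
    rw [hP, ← narrowClassNumber_eq_index]
    haveI : Finite (NarrowClassGroup L) := finite_rayClassGroup top_ne_bot
    exact Nat.card_pos.ne'
  -- `σ` on `A`
  set φ : (FractionalIdeal (𝓞 L)⁰ L)ˣ ⧸ P →* (FractionalIdeal (𝓞 L)⁰ L)ˣ ⧸ P :=
    QuotientGroup.map P P (MulDistribMulAction.toMonoidHom (FractionalIdeal (𝓞 L)⁰ L)ˣ σ)
      (fun x hx => isStable_totPosPrincipalIdeals σ hx) with hφdef
  have hφ : ∀ I : (FractionalIdeal (𝓞 L)⁰ L)ˣ, φ (mk I) = mk (σ • I) := fun I => rfl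
  -- `N_G I = I · σI`, and its class has ODD order
  have hnorm : ∀ I : (FractionalIdeal (𝓞 L)⁰ L)ˣ, mk (Herbrand.norm (L ≃ₐ[K] L) I) = mk I * φ (mk I) := fun I => by
    rw [norm_eq_mul_smul_of_finrank_eq_two hσ h2, map_mul, hφ]
  have hB : Odd (Nat.card ((ι.range).map mk)) := by
    have hle : (totPosPrincipalIdeals K).map ι ≤ P := (map_totPosPrincipalIdeals_le_z0 (K := K) (L := L) σ).trans z0_le
    have hdvd : P.relIndex ι.range ∣ ((totPosPrincipalIdeals K).map ι).relIndex ι.range :=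
      Subgroup.relIndex_dvd_of_le_left ι.range hle
    have hinj : Function.Injective ι := by
      have hinj' : Function.Injective (extendedHom L (𝓞 L) :
          FractionalIdeal (𝓞 K)⁰ K →+* FractionalIdeal (𝓞 L)⁰ L) := extendedHom_injective (𝓞 K) K L (𝓞 L)
      exact Units.map_injective hinj'
    have hK' : ((totPosPrincipalIdeals K).map ι).relIndex ι.range = narrowClassNumber K := by
      rw [MonoidHom.range_eq_map, Subgroup.relIndex_map_map_of_injective _ _ hinj, Subgroup.relIndex_top_right,
        narrowClassNumber_eq_index]
    rw [← Subgroup.relIndex_ker, hmk_ker]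
    rw [hK'] at hdvd
    exact hK.of_dvd_nat hdvd
  have hNodd : ∀ I : (FractionalIdeal (𝓞 L)⁰ L)ˣ, Odd (orderOf (mk I * φ (mk I))) := fun I => by
    rw [← hnorm]
    obtain ⟨J, hJ⟩ := norm_mem_range_unitsMap_extendedHom hσ I
    exact hB.of_dvd_nat (Subgroup.orderOf_dvd_natCard _ ⟨_, ⟨J, rfl⟩, by rw [hJ]⟩)
  -- `T = A[2]`, `F = A^G = Z/P⁺`
  set T : Subgroup ((FractionalIdeal (𝓞 L)⁰ L)ˣ ⧸ P) := (powMonoidHom (α := (FractionalIdeal (𝓞 L)⁰ L)ˣ ⧸ P) 2).ker with hT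
  set F : Subgroup ((FractionalIdeal (𝓞 L)⁰ L)ˣ ⧸ P) := Z.map mk with hF
  have hPZ : P ≤ Z := fun p hp =>
    mem_z0.mpr ⟨Subgroup.mem_top p, P.div_mem (isStable_totPosPrincipalIdeals σ hp) hp⟩
  have hmemF : ∀ I : (FractionalIdeal (𝓞 L)⁰ L)ˣ, mk I ∈ F ↔ φ (mk I) = mk I := by
    intro I
    have h1 : mk I ∈ F ↔ I ∈ Z := by
      rw [hF, ← Subgroup.mem_comap, Subgroup.comap_map_eq_self (by rw [hmk_ker]; exact hPZ)]
    rw [h1, hZ, mem_z0, hφ, hmk_eq]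
    simp only [Subgroup.mem_top, true_and]
    constructor
    · intro h
      have := P.inv_mem h
      rwa [div_eq_mul_inv, mul_inv_rev, inv_inv, mul_comm] at this
    · intro h
      have := P.inv_mem h
      rwa [mul_inv_rev, inv_inv, mul_comm, ← div_eq_mul_inv] at this
  have hTF : T ≤ F := by
    intro a ha
    obtain ⟨I, rfl⟩ := hmk_surj a
    have ha2 : mk I ^ 2 = 1 := ha
    have hprod1 : mk I * φ (mk I) = 1 := by
      have hcomm : Commute (mk I) (φ (mk I)) := mul_comm (mk I) (φ (mk I))
      have h4 : (mk I * φ (mk I)) ^ 2 = 1 := by rw [hcomm.mul_pow, ← map_pow φ, ha2, map_one]; exact one_mul (1 : (FractionalIdeal (𝓞 L)⁰ L)ˣ ⧸ P)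
      have hdvd : orderOf (mk I * φ (mk I)) ∣ 2 := orderOf_dvd_of_pow_eq_one h4
      rcases (Nat.dvd_prime Nat.prime_two).mp hdvd with h1 | h2'
      · exact orderOf_eq_one_iff.mp h1
      · exact absurd (hNodd I) (by rw [h2']; decide)
    rw [hmemF]
    have hinv : φ (mk I) = (mk I)⁻¹ := eq_inv_of_mul_eq_one_right hprod1
    rw [hinv, inv_eq_iff_mul_eq_one, ← pow_two, ha2]
  have hFT : ∀ f ∈ F, ∃ m : ℕ, Odd m ∧ f ^ m ∈ T := by
    intro f hf
    obtain ⟨I, rfl⟩ := hmk_surj f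
    refine ⟨orderOf (mk I * φ (mk I)), hNodd I, ?_⟩
    have hfix : φ (mk I) = mk I := (hmemF I).mp hf
    have hsq : mk I * mk I = mk I * φ (mk I) := by rw [hfix]
    rw [hT, MonoidHom.mem_ker, powMonoidHom_apply, ← pow_mul, mul_comm, pow_mul, pow_two, hsq]
    exact pow_orderOf_eq_one _
  -- counting
  have hodd : Odd (T.relIndex F) := odd_relIndex_of_forall_exists_odd_pow_mem hFT
  have hcardF : Nat.card F = Nat.card T * T.relIndex F := by
    rw [Subgroup.relIndex, ← Nat.card_congr (Subgroup.subgroupOfEquivOfLe hTF).toEquiv, Subgroup.card_mul_index]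
  haveI : Fact (Nat.Prime 2) := ⟨Nat.prime_two⟩
  obtain ⟨a, ha⟩ : ∃ a : ℕ, Nat.card T = 2 ^ a := by
    refine IsPGroup.iff_card.mp fun g => ⟨1, Subtype.ext ?_⟩
    rw [pow_one, Subgroup.coe_pow, OneMemClass.coe_one]
    exact g.2
  have hFZ : Nat.card F = P.relIndex Z := by rw [hF, ← Subgroup.relIndex_ker, hmk_ker]
  have hformula := relIndex_z0_totPosPrincipalIdeals_mul_two_eq_mul_two_pow hσ h2 hK
  rw [← hZ, ← hP, ← hFZ, hcardF, ha] at hformula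
  -- `2^a · m₀ · 2 = h⁺(K) · 2^t` ⟹ `a + 1 = t`
  have hat : a + 1 = {v : HeightOneSpectrum (𝓞 K) | v.asIdeal.ramificationIdxIn (𝓞 L) ≠ 1}.ncard := by
    apply pow_two_mul_odd_inj hodd hK
    calc 2 ^ (a + 1) * T.relIndex F = 2 ^ a * T.relIndex F * 2 := by ring
      _ = narrowClassNumber K * 2 ^ {v : HeightOneSpectrum (𝓞 K) | v.asIdeal.ramificationIdxIn (𝓞 L) ≠ 1}.ncard := hformula
      _ = _ := mul_comm _ _
  -- `[A : A²] = #A[2] = 2^a`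
  have hrankA : (powMonoidHom (α := (FractionalIdeal (𝓞 L)⁰ L)ˣ ⧸ P) 2).range.index = 2 ^ a := by
    rw [index_range_powMonoidHom_eq_card_ker', ← hT, ha]
  -- transport to `NarrowClassGroup L = (idealsPrimeTo ⊤) ⧸ (ray ⊤)`
  set T₀ : Subgroup (FractionalIdeal (𝓞 L)⁰ L)ˣ := idealsPrimeTo (⊤ : Ideal (𝓞 L)) with hT₀
  set R : Subgroup T₀ := (ray (⊤ : Ideal (𝓞 L))).subgroupOf T₀ with hR
  have hRP : R ≤ P.comap T₀.subtype := by
    intro x hx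
    rw [hR, Subgroup.mem_subgroupOf, ray_top] at hx
    exact hx
  set e₀ : T₀ ⧸ R →* (FractionalIdeal (𝓞 L)⁰ L)ˣ ⧸ P := QuotientGroup.map R P T₀.subtype hRP with he₀
  have he₀mk : ∀ x : T₀, e₀ (QuotientGroup.mk x) = mk (x : (FractionalIdeal (𝓞 L)⁰ L)ˣ) := fun x => rfl
  have hbij : Function.Bijective e₀ := by
    constructor
    · intro q₁ q₂ h
      obtain ⟨x₁, rfl⟩ := QuotientGroup.mk_surjective q₁
      obtain ⟨x₂, rfl⟩ := QuotientGroup.mk_surjective q₂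
      rw [he₀mk, he₀mk, hmk_eq] at h
      refine QuotientGroup.eq.mpr ?_
      rw [hR, Subgroup.mem_subgroupOf, ray_top, Subgroup.coe_mul, Subgroup.coe_inv]
      exact h
    · intro q
      obtain ⟨I, rfl⟩ := hmk_surj q
      exact ⟨QuotientGroup.mk ⟨I, by rw [hT₀, idealsPrimeTo_top]; trivial⟩, he₀mk _⟩
  have hmap : ((powMonoidHom (α := T₀ ⧸ R) 2).range).map e₀ =
      (powMonoidHom (α := (FractionalIdeal (𝓞 L)⁰ L)ˣ ⧸ P) 2).range := by
    ext y
    constructor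
    · rintro ⟨x, ⟨z, rfl⟩, rfl⟩
      exact ⟨e₀ z, by rw [powMonoidHom_apply, powMonoidHom_apply, map_pow]⟩
    · rintro ⟨y, rfl⟩
      obtain ⟨q, rfl⟩ := hbij.2 y
      exact ⟨q ^ 2, ⟨q, rfl⟩, by rw [powMonoidHom_apply, map_pow]⟩
  have htransport : (powMonoidHom (α := (FractionalIdeal (𝓞 L)⁰ L)ˣ ⧸ P) 2).range.index =
      (powMonoidHom (α := T₀ ⧸ R) 2).range.index := by
    rw [← hmap, Subgroup.index_map_of_bijective hbij]
  -- assemble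
  change (powMonoidHom (α := T₀ ⧸ R) 2).range.index * 2 = _
  rw [← htransport, hrankA, ← pow_succ, hat, ← finprod_ramificationIdxIn_eq_pow_of_prime Nat.prime_two h2]

/-- **`rank₂ Cl⁺(L) = t − 1`** in the form `[Cl⁺(L) : Cl⁺(L)²] · 2 = 2^t`, `t = #{𝔭 : e_𝔭(L/K) ≠ 1}` the number of finite primes of `K`
ramified in `L` (`L/K` Galois quadratic, `L` totally real, `h⁺(K)` odd). [cite: Gras2003, IV.4] [cite: FrohlichTaylor1990, Ch. V §2] -/
theorem index_range_pow_two_narrowClassGroup_mul_two_eq_two_pow [IsGalois K L] [IsTotallyReal L] {σ : L ≃ₐ[K] L}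
    (hσ : ∀ τ : L ≃ₐ[K] L, τ ∈ Subgroup.zpowers σ) (h2 : Module.finrank K L = 2) (hK : Odd (narrowClassNumber K)) :
    (powMonoidHom (α := NarrowClassGroup L) 2).range.index * 2 =
      2 ^ {v : HeightOneSpectrum (𝓞 K) | v.asIdeal.ramificationIdxIn (𝓞 L) ≠ 1}.ncard := by
  rw [index_range_pow_two_narrowClassGroup_mul_two_eq hσ h2 hK, finprod_ramificationIdxIn_eq_pow_of_prime Nat.prime_two h2]

end Literature.NumberTheory.NumberFields.AmbiguousClass

end
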